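import Summits.MatrixMultiplication.MatrixMultiplication.Theses.GLnSeparatingDesigns

/-!
# Route `GLnSeparatingDesigns` — the assembly item

Item `stmt-MatrixMultiplication-18364` (`Assembly`) of route
`route-MatrixMultiplication-GLnSeparatingDesigns` is the implication

  `BorderHalfDimensionDesigns → SeparationDegreeCost → MatrixMultiplication`,

i.e. BCGPU's printed question (Blasiak–Cohn–Grochow–Pratt–Umans 2024, §4 p. 33, border reading:
half-dimensional TPP designs in `GL_n(ℂ)` with separating degree `q^(1+o(1))`) together with the
printed price (Cor. 2.8 / Thm. 2.6: `(N₁N₂N₃)^(ω/3) ≤ s^((n(n-1)/2)(ω-2)) · C(s+n²,n²)`) decide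
`ω(ℂ) = 2`.  This is, verbatim, the type of the route's kernel-checked deciding theorem
`Summit.MatrixMultiplication.MatrixMultiplication.Theses.GLnSeparatingDesigns.closes` (pure
real-analysis bookkeeping: if `ω = 2 + t > 2`, take `ε = t/8`, the `n` it yields, `δ = t/(32n)`,
`q ≥ exp(128 n log n/(5t) + 1)`; the cost inequality with `C(s+n²,n²) ≤ (s n²)^(n²)` gives
`(5tn/64) log q ≤ 2 n² log n`, contradicting the choice of `q`; `2 ≤ ω` is `omega_two_le`).
This file closes the item by unfolding the route decl and applying `closes`.
-/

-- single-conjunct summit: the mandated namespace `Summit.MatrixMultiplication.MatrixMultiplication.…`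
-- repeats `MatrixMultiplication` (summit = sub-problem), which `linter.dupNamespace` would flag.
set_option linter.dupNamespace false
set_option autoImplicit false

namespace Summit.MatrixMultiplication.MatrixMultiplication.Theorems

open Summit.MatrixMultiplication.MatrixMultiplication.Theses.GLnSeparatingDesigns in
/-- **Assembly of route GLnSeparatingDesigns** (settles `stmt-MatrixMultiplication-18364`, exact route
signature `Summit.MatrixMultiplication.MatrixMultiplication.Theses.GLnSeparatingDesigns.Assembly`):
half-dimensional border TPP designs in `GL_n(ℂ)` (`BorderHalfDimensionDesigns`, BCGPU 2024 §4) and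
the separation-degree price (`SeparationDegreeCost`, BCGPU 2024 Cor. 2.8 / Thm. 2.6) together give
`MatrixMultiplication` (`ω(ℂ) = 2`).  This is exactly the route's deciding theorem `closes`. -/
theorem glnSeparatingDesigns_assembly_proof :
    Summit.MatrixMultiplication.MatrixMultiplication.Theses.GLnSeparatingDesigns.Assembly := by
  unfold Summit.MatrixMultiplication.MatrixMultiplication.Theses.GLnSeparatingDesigns.Assembly
  exact fun h₁ h₂ => closes h₁ h₂

end Summit.MatrixMultiplication.MatrixMultiplication.Theorems
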